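import Mathlib
import Literature.Analysis.ValidatedNumerics.WeightedWienerAlgebra
import Literature.Analysis.ValidatedNumerics.ConeDirichletInverseOperator
import Literature.Analysis.Calculus.RadiiPolynomialPolynomialNonlinearity
import HarnessLib

/-!
# The semilinear radii-polynomial closing ON the cone algebra `ℓ¹_ϱ(ζ^a ζ̄^b)` — no identification left

Topic `Literature/Analysis/ValidatedNumerics`.  This file assembles three tree results into the
statement a certnum F2 (B-SL) certificate instantiates, with every space and operator CONCRETE:

* `WienerAlgebra.Wiener (coneSubmultWeight hϱ)` (`WeightedWienerAlgebra.lean`): the real coefficient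
  families `u = Σ u_{ab} ζ^a ζ̄^b` with `‖u‖_ϱ = Σ |u_{ab}| ϱ^{a+b} < ∞`, Cauchy product — a commutative unital
  real Banach algebra (`NormedCommRing`, `NormOneClass`, `NormedAlgebra ℝ`, `CompleteSpace`);
* `ConeMonomial.dirichletInvKer` / `colBound_dirichletInvKer` (`ConeDirichletInverseOperator.lean`): the
  termwise Dirichlet inverse `Δ_D⁻¹` as a kernel on `ℕ × ℕ` with weighted column bound `(ϱ²+1)/4`;
  here it becomes the bounded linear map `dirInv hϱ : W →L[ℝ] W` with `‖dirInv‖ ≤ (ϱ²+1)/4`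
  (`norm_dirInv_le`) through `WienerAlgebra.Wiener.kerOp` and the index equivalence `ℕ^{Fin 2} ≃ ℕ × ℕ`;
* `PolynomialNonlinearity.existsUnique_zero_of_semilin` (`RadiiPolynomialPolynomialNonlinearity.lean`):
  the general-degree radii polynomial for `F(x) = x − L(v x + Σ_k c_k x^k) − g` in a commutative Banach
  algebra.

**`cone_existsUnique_zero_of_semilin`:** for `ϱ ≥ 1`, data `v, g, c_k, x̄ ∈ W`, an injective
`A : W →L W` with `‖A F(x̄)‖ ≤ Y₀`, `‖I − A∘DF(x̄)‖ ≤ Z₁`, `‖A‖ ≤ a`, `‖x̄‖ ≤ U`, `‖c_k‖ ≤ γ_k` and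
`Y₀ + (Z₁ + a·(ϱ²+1)/4·polyZ γ m U r)·r < r`, the map
`F(x) = x − Δ_D⁻¹(v x + Σ_{k≤m} c_k x^k) − g` has a unique zero in `B̄(x̄, r) ⊂ W` and the Newton-like
iterates converge to it — the exact shape of the cell's semilinear closings (`pub/certnum/ode/F2-ROUTE-A.md`
§4 (B-SL): `κ = normA·(ϱ²+1)/4`, `Z₂(r) = κ Σ k‖C_k‖[(‖ū‖+r)^{k−1} − ‖ū‖^{k−1}]`).

Sources as in the three files: [ArioliKoch2019] §3 Lemma 3.1, Prop. 3.2, §4 Lemma 4.1;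
[GameiroLessard2010] §3; [HungriaLessardMirelesJames2016] §2.1, Cor. 1, §3 Prop. 1.

## What is NOT covered

The certificate's numbers (`Y₀`, `Z₁`, `a = ‖A‖`-bound, `U`, `γ_k`, `r`) are hypotheses — they are what
the producer computes in exact/interval arithmetic and the two verifiers re-derive; the identification of
gridfusion's PDE with `F` (Liouville substitution p532316, conformal pull-back p550475, cone Laplacian
p537378) is typed elsewhere and not restated; no float model.

## Provenance

AI-produced formalisation (cell certnum, seat certnum-ode-2, 2026-08-27).
-/

set_option autoImplicit false

open scoped BigOperators
open Metric Filter
open scoped Topology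

noncomputable section

namespace Literature.Analysis.ValidatedNumerics

namespace ConeSemilinear

open WeightedSeq WienerAlgebra ConeMonomial
open Literature.Analysis.Calculus Literature.Analysis.Calculus.PolynomialNonlinearity

/-- The index equivalence `(Fin 2 →₀ ℕ) ≃ ℕ × ℕ`, `n ↦ (n 0, n 1)`.
[cite: ArioliKoch2019, §3 eq. (3.1) (two-index coefficient families)] -/
def idx : (Fin 2 →₀ ℕ) ≃ ℕ × ℕ :=
  (Finsupp.equivFunOnFinite.trans (piFinTwoEquiv fun _ => ℕ))

/-- [cite: ArioliKoch2019, §3 eq. (3.1)] -/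
@[simp] theorem idx_apply (n : Fin 2 →₀ ℕ) : idx n = (n 0, n 1) := rfl

/-- The cone weight in the two indexings agrees: `ω(n) = ϱ^{n₀+n₁} = coneWeight ϱ (idx n)`.
[cite: ArioliKoch2019, §3 eq. (3.2)] -/
theorem coneSubmultWeight_eq {ϱ : ℝ} (hϱ : 1 ≤ ϱ) :
    (coneSubmultWeight hϱ).toFun = fun n => coneWeight ϱ (idx n) := by
  funext n
  rw [coneSubmultWeight_apply, idx_apply, coneWeight]

/-- A column bound transfers along an index equivalence (the two weighted column sums are the same
series). [cite: HungriaLessardMirelesJames2016, Cor. 1 p. 1434] -/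
theorem colBound_comp_equiv {ι κ : Type*} (e : ι ≃ κ) {ω ω' : κ → ℝ} {M : κ → κ → ℝ} {C : ℝ}
    (h : ColBound ω ω' M C) :
    ColBound (fun i => ω (e i)) (fun i => ω' (e i)) (fun k m => M (e k) (e m)) C := by
  intro m
  have : (∑' k : ι, ENNReal.ofReal (|M (e k) (e m)| * ω' (e k)))
      = ∑' j : κ, ENNReal.ofReal (|M j (e m)| * ω' j) :=
    e.tsum_eq (fun j => ENNReal.ofReal (|M j (e m)| * ω' j))
  rw [this]
  exact h (e m)

/-- The Dirichlet-inverse kernel on the exponent index `Fin 2 →₀ ℕ`.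
[cite: ArioliKoch2019, §2 Lemma 2.1 (termwise Dirichlet inverse)] -/
def dirKer (k m : Fin 2 →₀ ℕ) : ℝ := dirichletInvKer (idx k) (idx m)

/-- Its column bound `(ϱ²+1)/4` for the cone weight (from `ConeMonomial.colBound_dirichletInvKer`).
[cite: ArioliKoch2019, §3 Prop. 3.2 (monomial version, all columns)] -/
theorem colBound_dirKer {ϱ : ℝ} (hϱ : 1 ≤ ϱ) :
    ColBound (coneSubmultWeight hϱ).toFun (coneSubmultWeight hϱ).toFun dirKer ((ϱ ^ 2 + 1) / 4) := by
  rw [coneSubmultWeight_eq hϱ]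
  exact colBound_comp_equiv idx (colBound_dirichletInvKer hϱ)

/-- **`Δ_D⁻¹` as a bounded linear map on the cone algebra** `W = Wiener (coneSubmultWeight hϱ)`.
[cite: ArioliKoch2019, §3 Prop. 3.2; HungriaLessardMirelesJames2016 Cor. 1] -/
def dirInv {ϱ : ℝ} (hϱ : 1 ≤ ϱ) :
    Wiener (coneSubmultWeight hϱ) →L[ℝ] Wiener (coneSubmultWeight hϱ) :=
  Wiener.kerOp (by positivity) (colBound_dirKer hϱ)

/-- **`‖Δ_D⁻¹‖_{W→W} ≤ (ϱ²+1)/4`** — the factor of the producer's `κ = ‖A‖(ϱ²+1)/4`.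
[cite: ArioliKoch2019, §3 Prop. 3.2 (monomial version); HungriaLessardMirelesJames2016 Cor. 1] -/
theorem norm_dirInv_le {ϱ : ℝ} (hϱ : 1 ≤ ϱ) : ‖dirInv hϱ‖ ≤ (ϱ ^ 2 + 1) / 4 :=
  Wiener.norm_kerOp_le _ _

/-- The coefficients of `Δ_D⁻¹ φ`: `(Δ_D⁻¹φ)_k = Σ_m Δ_D⁻¹(k,m) φ_m` (kernel entries
`ConeMonomial.dirichletInvKer_apply_raise/_apply_harm/_eq_zero`).
[cite: ArioliKoch2019, §2 Lemma 2.1] -/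
theorem coeff_dirInv {ϱ : ℝ} (hϱ : 1 ≤ ϱ) (φ : Wiener (coneSubmultWeight hϱ)) (k : Fin 2 →₀ ℕ) :
    MvPowerSeries.coeff k ((dirInv hϱ φ : Wiener (coneSubmultWeight hϱ)) : MvPowerSeries (Fin 2) ℝ)
      = apply dirKer (coeffFun (φ : MvPowerSeries (Fin 2) ℝ)) k :=
  Wiener.coeff_kerOp _ _ φ k

/-- **The (B-SL) closing on the cone algebra, nothing left to identify.**  Let `ϱ ≥ 1`,
`W = ℓ¹_ϱ(ζ^aζ̄^b)` (`Wiener (coneSubmultWeight hϱ)`), `v, g, x̄ ∈ W`, coefficients `c_k ∈ W` (`k ≤ m`),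
and `F(x) = x − Δ_D⁻¹(v·x + Σ_{k≤m} c_k x^k) − g` (`PolynomialNonlinearity.semilinMap (dirInv hϱ) v c m g`).
If `A : W →L W` is injective, `‖A F(x̄)‖ ≤ Y₀`, `‖I − A∘DF(x̄)‖ ≤ Z₁`, `‖A‖ ≤ a`, `‖x̄‖ ≤ U`,
`‖c_k‖ ≤ γ_k`, `0 ≤ r` and
`Y₀ + (Z₁ + a · (ϱ²+1)/4 · Σ_{k≤m} k γ_k ((U+r)^{k−1} − U^{k−1})) · r < r`,
then `F` has exactly one zero in the closed ball `B̄(x̄, r)` of `W`, and the Newton-like iterates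
`x ↦ x − A F(x)` started at `x̄` converge to it.
[cite: ArioliKoch2019, §4 Lemma 4.1 (pp. 9–10); GameiroLessard2010 §3 Cor. 3.6; HungriaLessardMirelesJames2016 §3 Prop. 1] -/
theorem cone_existsUnique_zero_of_semilin {ϱ : ℝ} (hϱ : 1 ≤ ϱ)
    {A : Wiener (coneSubmultWeight hϱ) →L[ℝ] Wiener (coneSubmultWeight hϱ)}
    {v g xbar : Wiener (coneSubmultWeight hϱ)} {c : ℕ → Wiener (coneSubmultWeight hϱ)} {m : ℕ}
    {Y₀ Z₁ a U r : ℝ} {γ : ℕ → ℝ} (hr : 0 ≤ r) (hA : Function.Injective A)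
    (hY : ‖A (semilinMap (dirInv hϱ) v c m g xbar)‖ ≤ Y₀)
    (hZ₁ : ‖ContinuousLinearMap.id ℝ _ - A.comp (semilinDeriv (dirInv hϱ) v c m xbar)‖ ≤ Z₁)
    (ha : ‖A‖ ≤ a) (hU : ‖xbar‖ ≤ U) (hγ : ∀ k, ‖c k‖ ≤ γ k)
    (h : Y₀ + (Z₁ + a * ((ϱ ^ 2 + 1) / 4) * polyZ γ m U r) * r < r) :
    ∃ x ∈ closedBall xbar r, semilinMap (dirInv hϱ) v c m g x = 0 ∧
      (∀ y ∈ closedBall xbar r, semilinMap (dirInv hϱ) v c m g y = 0 → y = x) ∧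
      Tendsto (fun n => (newtonLikeMap A (semilinMap (dirInv hϱ) v c m g))^[n] xbar) atTop (𝓝 x) :=
  existsUnique_zero_of_semilin hr hA hY hZ₁ ha (norm_dirInv_le hϱ) hU hγ h

end ConeSemilinear

end Literature.Analysis.ValidatedNumerics
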